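import Summits.ResolutionOfSingularities.ResolutionOfSingularities.Theorems.HilbertSamuelEliminationCampaignW42BlowupLocallyAtPoint
import Summits.ResolutionOfSingularities.ResolutionOfSingularities.Theorems.HilbertSamuelEliminationCampaignW42ProjDirectrixOfDirDimEq
import Literature.AlgebraicGeometry.CossartJannsenSaito2020.ProjDirLine
import HarnessLib

/-!
# [OURS · L1 W4.2] The RELATIVE `ProjDir_line` and P-b: over a point `y` of the centre with `e_y = 1` (e.g. the generic
# point `η_{q−1}` of the curve `C_{q−1}`) there is AT MOST ONE near point, it is `κ(y)`-rational and lies on `ℙ(Dir_y)` —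
# two doors: fact-free under `e_y = ē_y`, or modulo the print binder `Thm314_point_locus` under (F1)
# (campaign s42, cell res-hironaka; chain w42 RECOGNITION-CUT (R2) «at most one point `η_q` near to `η_{q−1}`,
# `k(η_{q−1}) = k(η_q)`», CJS LNM 2270 p. 104; crux stmt-ResolutionOfSingularities-18506 / conjunct 19249; `--supports`)

HONEST FRAMING. OURS (slot W4.2, prover res-L1-s42-pv-1, gen 4; P-b of res-L1-w42-plan-1 RULINGS v3.12-3 (O)). For a blow-up
`π : X' → X` of a locally noetherian `X` in a closed `C` (reduced) and a point `y` with `(Spec 𝒪_{X,y} → X)⁻¹(C) = {𝔪_y}`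
(loc) — e.g. `y` a generic point of `C` — we prove:

* **`projDirectrixFibre_subsingleton_of_dirDim_eq_one`** — the RELATIVE form of res-type-053's `projDir_line` (CJS Def. 6.34
  (i) / p. 103 L32 at `t = 1`), fact-free: if `e_y(X) = 1` then `ℙ(Dir_y(X)) ⊂ π⁻¹(y)` (tree `projDirectrixFibre π y`) has at
  most one point and there `κ(y) → κ(x')` is an isomorphism — `y` closed OR NOT. (Base change to `Spec 𝒪_{X,y}`, where the
  step is the blow-up of the closed point — `…CampaignW42BlowupLocallyAtPoint` — and `projDir_line` there.)
* **`nearFibre_subsingleton_of_dirDim_eq_geomDirDim_eq_one`** (FACT-FREE DOOR) — if `X` is excellent and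
  `e_y(X) = ē_y(X) = 1` then the points of `X'` over `y` NEAR to `y` at level `N` (`H^N_{X'}(x') = H^N_X(y)`) form a
  subsingleton, and such a point is `κ(y)`-rational and on `ℙ(Dir_y(X))` (confinement by
  `isOnProjDirectrix_of_near_of_dirDim_eq_geomDirDim`, every characteristic, no binder). At `η_{q−1}` CJS have exactly
  `e = ē = 1` ((6.24) with Thm. 3.10 (4) in its `∀ K` form, their (F3) `e = ē` at `x`).
* **`nearFibre_subsingleton_of_charHypothesis`** (PRINT DOOR) — the same conclusion from `e_y(X) = 1`, (F1)
  `CharHypothesis X y`, `dim X ≤ N`, modulo the typed print binder `Thm314_point_locus` (res-type-053), transferred to the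
  non-closed `y` through the local scheme (`Helpers.charHypothesis_spec_stalk`, lead-1).
* generic-point forms `…_genericPoint_…` (hypothesis `IsGenericPoint y C`) and TOWER forms at the generic point `η` of
  `T.C j` for chain w42's `BlowupTower`s (`BlowupTower.centre_nearFibre_subsingleton_…`), the shape RECOGNITION-GEOMETRY
  (R2) `IsFundamentalUnit.centre_near` consumes.

NOTHING here is a statement of H. Hironaka's manuscript [Hironaka2017]; the print door carries the named fact BY NAME and
asserts nothing about it. AI review is weaker than expert review. References (orientation only): V. Cossart, U. Jannsen,
S. Saito, LNM 2270 (2020), Thm. 3.14, Def. 6.34 (i), (6.24), p. 103 L32, p. 104, p. 107.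
-/

noncomputable section

-- single-conjunct summit: the doubled namespace component `ResolutionOfSingularities` is mandated
set_option linter.dupNamespace false

open CategoryTheory CategoryTheory.Limits AlgebraicGeometry TopologicalSpace IsLocalRing
open Literature.AlgebraicGeometry.Resolution Literature.AlgebraicGeometry.CossartJannsenSaito2020
open Literature.RingTheory.HilbertSamuel
open Scheme.IdealSheafData

namespace Summit.ResolutionOfSingularities.ResolutionOfSingularities.Theorems

namespace CampaignW42

universe u

section OneBlowup

variable {X X' : Scheme.{u}} [IsLocallyNoetherian X] {π : X' ⟶ X} {C : Closeds X} {y : X}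

omit [IsLocallyNoetherian X] in
/-- The closed point of `Spec 𝒪_{X,y}` is closed. [folklore] -/
theorem isClosed_singleton_closedPoint_stalk (y : X) :
    IsClosed ({closedPoint (X.presheaf.stalk y)} : Set ↥(Spec (X.presheaf.stalk y))) :=
  (PrimeSpectrum.isClosed_singleton_iff_isMaximal _).mpr (inferInstanceAs (maximalIdeal (X.presheaf.stalk y)).IsMaximal)

/-- `0 < dim 𝒪_{X,y}` as soon as `e_y(X) ≥ 1` (`e ≤ dim`, CJS Lemma 2.20 (1)). [cite: CossartJannsenSaito2020, Lemma 2.20 (1)] -/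
theorem ringKrullDim_stalk_pos_of_one_le_dirDim (h : 1 ≤ Scheme.dirDim X y) : 0 < ringKrullDim (X.presheaf.stalk y) := by
  have h1 : ((1 : ℕ) : WithBot ℕ∞) ≤ ringKrullDim (X.presheaf.stalk y) :=
    le_trans (by exact_mod_cast h) (Scheme.natCast_dirDim_le_ringKrullDim_stalk y)
  exact lt_of_lt_of_le (by decide) h1

/-- **The RELATIVE `ProjDir_line`** (CJS Def. 6.34 (i) / p. 103 L32 «if `e_x(X) ≤ 1` then `k(y) = k(x)`» at a point `y` that
need NOT be closed). Let `π : X' → X` be a blow-up in the closed `C` (reduced structure) and `y` a point with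
`(Spec 𝒪_{X,y} → X)⁻¹(C) = {𝔪_y}` and `e_y(X) = 1`. Then the set `projDirectrixFibre π y` of points over `y` on `ℙ(Dir_y(X))`
has at most one point, and at such a point `κ(y) → κ(x')` is an isomorphism. Fact-free (res-type-053's `projDir_line` on the
local blow-up). [cite: CossartJannsenSaito2020, Def. 6.34 (i), p. 103, p. 107] -/
theorem projDirectrixFibre_subsingleton_of_dirDim_eq_one (hπ : IsBlowup π (vanishingIdeal C))
    (hCy : (X.fromSpecStalk y).base ⁻¹' (C : Set X) = {closedPoint (X.presheaf.stalk y)}) (he : Scheme.dirDim X y = 1) :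
    (projDirectrixFibre π y).Subsingleton ∧ ∀ x' ∈ projDirectrixFibre π y, IsIso (π.residueFieldMap x') := by
  have hloc := isBlowup_pullback_snd_fromSpecStalk π y hπ hCy (isClosed_singleton_closedPoint_stalk y)
  have he' : Scheme.dirDim (Spec (X.presheaf.stalk y)) (closedPoint (X.presheaf.stalk y)) = 1 := by
    rw [Scheme.dirDim_fromSpecStalk_closedPoint]; exact he
  obtain ⟨hsub, hrat⟩ := projDir_line _ _ (pullback.snd π (X.fromSpecStalk y)) _ (isClosed_singleton_closedPoint_stalk y) hloc he'
  -- every point of `ℙ(Dir_y)` over `y` lifts to a point of `ℙ(Dir)` of the local blow-up over the closed point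
  have lift : ∀ x' ∈ projDirectrixFibre π y, ∃ s : ↥(pullback π (X.fromSpecStalk y)),
      (pullback.fst π (X.fromSpecStalk y)).base s = x' ∧
        s ∈ projDirectrixFibre (pullback.snd π (X.fromSpecStalk y)) (closedPoint (X.presheaf.stalk y)) := by
    intro x' hx'
    obtain ⟨hx'y, hon⟩ := (mem_projDirectrixFibre π y x').mp hx'
    obtain ⟨s, hs, hspt⟩ := exists_pullback_fst_eq_of_eq π y hx'y
    refine ⟨s, hs, (mem_projDirectrixFibre _ _ s).mpr ⟨hspt, ?_⟩⟩
    rw [isOnProjDirectrix_pullback_iff π y s, hs]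
    exact hon
  refine ⟨fun x₁ hx₁ x₂ hx₂ => ?_, fun x' hx' => ?_⟩
  · obtain ⟨s₁, hs₁, h₁⟩ := lift x₁ hx₁
    obtain ⟨s₂, hs₂, h₂⟩ := lift x₂ hx₂
    rw [← hs₁, ← hs₂, hsub h₁ h₂]
  · obtain ⟨s, hs, h⟩ := lift x' hx'
    have h1 := (isIso_residueFieldMap_pullback_iff π y s).mp (hrat s h)
    rwa [hs] at h1

/-- **Near points over `y` lie on `ℙ(Dir_y)` — fact-free door `e = ē`** (`…CampaignW42ProjDirectrixOfDirDimEq` read under (loc)).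
`X` excellent, `(Spec 𝒪_{X,y} → X)⁻¹(C) = {𝔪_y}`, `1 ≤ e_y(X) = ē_y(X)`, `x'` over `y` near at level `N`.
[cite: CossartJannsenSaito2020, Thm. 3.14, p. 103 (F3), p. 104] -/
theorem isOnProjDirectrix_of_near_of_preimage_eq (hX : Scheme.IsExcellent X) (hπ : IsBlowup π (vanishingIdeal C))
    (hCy : (X.fromSpecStalk y).base ⁻¹' (C : Set X) = {closedPoint (X.presheaf.stalk y)}) (he1 : 1 ≤ Scheme.dirDim X y)
    (he : Scheme.dirDim X y = Scheme.geomDirDim X y) {N : ℕ} {x' : X'} (hx' : π.base x' = y)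
    (hnear : Scheme.hsFun X' N x' = Scheme.hsFun X N y) : IsOnProjDirectrix π x' :=
  isOnProjDirectrix_of_near_of_dirDim_eq_geomDirDim hX hπ hx' (stalkIdeal_vanishingIdeal_eq_maximalIdeal_of_preimage_eq y hCy)
    (ringKrullDim_stalk_pos_of_one_le_dirDim he1) he hnear

/-- **Near points over `y` lie on `ℙ(Dir_y)` — print door (F1)**, modulo the typed point-centre binder `Thm314_point_locus`
(res-type-053), transferred to the (non-closed) point `y` through the local blow-up: `X` excellent with `dim X ≤ N`,
`(Spec 𝒪_{X,y} → X)⁻¹(C) = {𝔪_y}`, `CharHypothesis X y`, `1 ≤ e_y(X)`, `x'` over `y` near at level `N`.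
[cite: CossartJannsenSaito2020, Thm. 3.14, p. 104, p. 107] -/
theorem isOnProjDirectrix_of_near_of_charHypothesis (h314 : Thm314_point_locus.{u}) (hX : Scheme.IsExcellent X) {N : ℕ}
    (hN : topologicalKrullDim ↥X ≤ (N : WithBot ℕ∞)) (hπ : IsBlowup π (vanishingIdeal C))
    (hCy : (X.fromSpecStalk y).base ⁻¹' (C : Set X) = {closedPoint (X.presheaf.stalk y)}) (hchar : CharHypothesis X y)
    (he1 : 1 ≤ Scheme.dirDim X y) {x' : X'} (hx' : π.base x' = y) (hnear : Scheme.hsFun X' N x' = Scheme.hsFun X N y) :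
    IsOnProjDirectrix π x' := by
  have hcl := isClosed_singleton_closedPoint_stalk y
  have hloc := isBlowup_pullback_snd_fromSpecStalk π y hπ hCy hcl
  obtain ⟨s, hs, hspt⟩ := exists_pullback_fst_eq_of_eq π y hx'
  have hnear' : Scheme.hsFun (pullback π (X.fromSpecStalk y)) N s =
      Scheme.hsFun (Spec (X.presheaf.stalk y)) N (closedPoint (X.presheaf.stalk y)) := by
    haveI : IsLocallyNoetherian X' := by
      haveI : IsProper π := hπ.isProper
      exact LocallyOfFiniteType.isLocallyNoetherian π
    rw [hsFun_pullback_eq_iff π y N s, hs]; exact hnear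
  have hon : IsOnProjDirectrix (pullback.snd π (X.fromSpecStalk y)) s :=
    h314 _ _ (pullback.snd π (X.fromSpecStalk y)) _ hcl N s (isExcellent_Spec_stalk y hX)
      (isPermissible_vanishingIdeal_closedPoint y (ringKrullDim_stalk_pos_of_one_le_dirDim he1)) hloc
      ((topologicalKrullDim_Spec_stalk_le y).trans hN) hspt
      (SigmaMaxModificationsCorridor3.Helpers.charHypothesis_spec_stalk hchar) hnear'
  rw [isOnProjDirectrix_pullback_iff π y s, hs] at hon
  exact hon

/-- **P-b, FACT-FREE DOOR.** `π : X' → X` a blow-up of the excellent locally noetherian `X` in the closed `C` (reduced), `y`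
a point with `(Spec 𝒪_{X,y} → X)⁻¹(C) = {𝔪_y}` (e.g. the generic point of the irreducible `C`) and **`e_y(X) = ē_y(X) = 1`**.
Then, at every level `N`: the points of `X'` over `y` NEAR to `y` (`H^N_{X'}(x') = H^N_X(y)`) form a SUBSINGLETON, and such
a point is `κ(y)`-RATIONAL (`IsIso (π.residueFieldMap x')`) and lies on `ℙ(Dir_y(X))`. CJS p. 104: «By (6.24) and Theorem
5.20, there is at most one point `η_2 ∈ X_2` which is near to `η_1`. … Then `k(η_1) = k(η_2)`» — here in every characteristic,
with no characteristic hypothesis and no named fact. [cite: CossartJannsenSaito2020, p. 104, (6.24), Thm. 3.14, Def. 6.34 (i)] -/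
theorem nearFibre_subsingleton_of_dirDim_eq_geomDirDim_eq_one (hX : Scheme.IsExcellent X)
    (hπ : IsBlowup π (vanishingIdeal C))
    (hCy : (X.fromSpecStalk y).base ⁻¹' (C : Set X) = {closedPoint (X.presheaf.stalk y)}) (he : Scheme.dirDim X y = 1)
    (hē : Scheme.geomDirDim X y = 1) (N : ℕ) :
    {x' : X' | π.base x' = y ∧ Scheme.hsFun X' N x' = Scheme.hsFun X N y}.Subsingleton ∧
      ∀ x' : X', π.base x' = y → Scheme.hsFun X' N x' = Scheme.hsFun X N y →
        IsIso (π.residueFieldMap x') ∧ IsOnProjDirectrix π x' := by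
  obtain ⟨hsub, hrat⟩ := projDirectrixFibre_subsingleton_of_dirDim_eq_one hπ hCy he
  have hon : ∀ x' : X', π.base x' = y → Scheme.hsFun X' N x' = Scheme.hsFun X N y → IsOnProjDirectrix π x' :=
    fun x' hx' hnear => isOnProjDirectrix_of_near_of_preimage_eq hX hπ hCy (by omega) (he.trans hē.symm) hx' hnear
  refine ⟨fun x₁ hx₁ x₂ hx₂ => hsub ⟨hx₁.1, hon x₁ hx₁.1 hx₁.2⟩ ⟨hx₂.1, hon x₂ hx₂.1 hx₂.2⟩, fun x' hx' hnear => ?_⟩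
  exact ⟨hrat x' ⟨hx', hon x' hx' hnear⟩, hon x' hx' hnear⟩

/-- **P-b, PRINT DOOR (F1).** Same conclusion from `e_y(X) = 1`, `CharHypothesis X y` and `dim X ≤ N`, modulo the typed print
binder `Thm314_point_locus` (CJS Thm. 3.14 for point centres, res-type-053). [cite: CossartJannsenSaito2020, p. 104, Thm. 3.14] -/
theorem nearFibre_subsingleton_of_charHypothesis (h314 : Thm314_point_locus.{u}) (hX : Scheme.IsExcellent X) {N : ℕ}
    (hN : topologicalKrullDim ↥X ≤ (N : WithBot ℕ∞)) (hπ : IsBlowup π (vanishingIdeal C))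
    (hCy : (X.fromSpecStalk y).base ⁻¹' (C : Set X) = {closedPoint (X.presheaf.stalk y)}) (hchar : CharHypothesis X y)
    (he : Scheme.dirDim X y = 1) :
    {x' : X' | π.base x' = y ∧ Scheme.hsFun X' N x' = Scheme.hsFun X N y}.Subsingleton ∧
      ∀ x' : X', π.base x' = y → Scheme.hsFun X' N x' = Scheme.hsFun X N y →
        IsIso (π.residueFieldMap x') ∧ IsOnProjDirectrix π x' := by
  obtain ⟨hsub, hrat⟩ := projDirectrixFibre_subsingleton_of_dirDim_eq_one hπ hCy he
  have hon : ∀ x' : X', π.base x' = y → Scheme.hsFun X' N x' = Scheme.hsFun X N y → IsOnProjDirectrix π x' :=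
    fun x' hx' hnear => isOnProjDirectrix_of_near_of_charHypothesis h314 hX hN hπ hCy hchar (by omega) hx' hnear
  refine ⟨fun x₁ hx₁ x₂ hx₂ => hsub ⟨hx₁.1, hon x₁ hx₁.1 hx₁.2⟩ ⟨hx₂.1, hon x₂ hx₂.1 hx₂.2⟩, fun x' hx' hnear => ?_⟩
  exact ⟨hrat x' ⟨hx', hon x' hx' hnear⟩, hon x' hx' hnear⟩

/-! ### At a generic point of the centre -/

/-- **P-b at the generic point of the (irreducible, reduced) centre, fact-free door**: `C` closed with generic point `y`
(`IsGenericPoint y C`), `X` excellent, `e_y(X) = ē_y(X) = 1` ⟹ at most one point of `X' = Bℓ_C(X)` over `y` is near to `y`,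
and it is `κ(y)`-rational on `ℙ(Dir_y(X))`. [cite: CossartJannsenSaito2020, p. 104, (6.24)] -/
theorem nearFibre_subsingleton_genericPoint_of_dirDim_eq_geomDirDim_eq_one (hX : Scheme.IsExcellent X)
    (hπ : IsBlowup π (vanishingIdeal C)) (hy : IsGenericPoint y (C : Set X)) (he : Scheme.dirDim X y = 1)
    (hē : Scheme.geomDirDim X y = 1) (N : ℕ) :
    {x' : X' | π.base x' = y ∧ Scheme.hsFun X' N x' = Scheme.hsFun X N y}.Subsingleton ∧
      ∀ x' : X', π.base x' = y → Scheme.hsFun X' N x' = Scheme.hsFun X N y →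
        IsIso (π.residueFieldMap x') ∧ IsOnProjDirectrix π x' :=
  nearFibre_subsingleton_of_dirDim_eq_geomDirDim_eq_one hX hπ (preimage_fromSpecStalk_eq_singleton_of_isGenericPoint y hy)
    he hē N

/-- **P-b at the generic point of the centre, print door (F1)**, modulo `Thm314_point_locus`. [cite: CossartJannsenSaito2020, p. 104, Thm. 3.14] -/
theorem nearFibre_subsingleton_genericPoint_of_charHypothesis (h314 : Thm314_point_locus.{u}) (hX : Scheme.IsExcellent X)
    {N : ℕ} (hN : topologicalKrullDim ↥X ≤ (N : WithBot ℕ∞)) (hπ : IsBlowup π (vanishingIdeal C))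
    (hy : IsGenericPoint y (C : Set X)) (hchar : CharHypothesis X y) (he : Scheme.dirDim X y = 1) :
    {x' : X' | π.base x' = y ∧ Scheme.hsFun X' N x' = Scheme.hsFun X N y}.Subsingleton ∧
      ∀ x' : X', π.base x' = y → Scheme.hsFun X' N x' = Scheme.hsFun X N y →
        IsIso (π.residueFieldMap x') ∧ IsOnProjDirectrix π x' :=
  nearFibre_subsingleton_of_charHypothesis h314 hX hN hπ (preimage_fromSpecStalk_eq_singleton_of_isGenericPoint y hy) hchar he

end OneBlowup

/-! ## Tower forms, for RECOGNITION-GEOMETRY (R2): the stage `X_j ← X_{j+1} = Bℓ_{C_j}(X_j)` at the generic point of `C_j` -/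

section Tower

variable (T : BlowupTower.{u}) (j : ℕ) {η : T.X j}

/-- **(R2) input, fact-free door.** In a tower of blow-ups, let `η` be a generic point of the centre `C_j` (`IsGenericPoint η
(T.C j)`) with `X_j` excellent and `e_η(X_j) = ē_η(X_j) = 1` (CJS (6.24) at `η_{q−1}`). Then at every level `N` at most one
point of `X_{j+1}` over `η` is near to `η`, and such a point `ξ` has `κ(η) ⥲ κ(ξ)` and lies on `ℙ(Dir_η(X_j))` — CJS p. 104
«at most one point `η_q ∈ X_q` which is near to `η_{q−1}` … `k(η_{q−1}) = k(η_q)`», every characteristic, no named fact.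
[cite: CossartJannsenSaito2020, p. 104, Def. 6.34 (ii)/(iii), Def. 6.38 (iii)] -/
theorem BlowupTower.centre_nearFibre_subsingleton_of_dirDim_eq_geomDirDim_eq_one
    (hX : Scheme.IsExcellent (T.X j)) (hη : IsGenericPoint η (T.C j)) (he : T.dirDimAt j η = 1)
    (hē : T.geomDirDimAt j η = 1) (N : ℕ) :
    {ξ : T.X (j + 1) | (T.π j).base ξ = η ∧ Scheme.hsFun (T.X (j + 1)) N ξ = Scheme.hsFun (T.X j) N η}.Subsingleton ∧
      ∀ ξ : T.X (j + 1), (T.π j).base ξ = η → Scheme.hsFun (T.X (j + 1)) N ξ = Scheme.hsFun (T.X j) N η →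
        IsIso ((T.π j).residueFieldMap ξ) ∧ @IsOnProjDirectrix _ _ (T.ln j) (T.π j) ξ := by
  haveI : IsLocallyNoetherian (T.X j) := T.ln j
  exact nearFibre_subsingleton_genericPoint_of_dirDim_eq_geomDirDim_eq_one hX (T.isBlowup j) hη he hē N

/-- **(R2) input, print door (F1)**, modulo `Thm314_point_locus`: `η` a generic point of `C_j`, `X_j` excellent with
`dim X_j ≤ N`, `CharHypothesis (X_j) η`, `e_η(X_j) = 1`. [cite: CossartJannsenSaito2020, p. 104, Thm. 3.14] -/
theorem BlowupTower.centre_nearFibre_subsingleton_of_charHypothesis (h314 : Thm314_point_locus.{u})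
    (hX : Scheme.IsExcellent (T.X j)) {N : ℕ} (hN : topologicalKrullDim ↥(T.X j) ≤ (N : WithBot ℕ∞))
    (hη : IsGenericPoint η (T.C j)) (hchar : CharHypothesis (T.X j) η) (he : T.dirDimAt j η = 1) :
    {ξ : T.X (j + 1) | (T.π j).base ξ = η ∧ Scheme.hsFun (T.X (j + 1)) N ξ = Scheme.hsFun (T.X j) N η}.Subsingleton ∧
      ∀ ξ : T.X (j + 1), (T.π j).base ξ = η → Scheme.hsFun (T.X (j + 1)) N ξ = Scheme.hsFun (T.X j) N η →
        IsIso ((T.π j).residueFieldMap ξ) ∧ @IsOnProjDirectrix _ _ (T.ln j) (T.π j) ξ := by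
  haveI : IsLocallyNoetherian (T.X j) := T.ln j
  exact nearFibre_subsingleton_genericPoint_of_charHypothesis h314 hX hN (T.isBlowup j) hη hchar he

end Tower

end CampaignW42

end Summit.ResolutionOfSingularities.ResolutionOfSingularities.Theorems

end
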